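import Summits.BirchSwinnertonDyer.BirchSwinnertonDyer.Theorems.EisensteinPrimesMazurMCOnCellBAnalyticMuOffLocus
import Summits.BirchSwinnertonDyer.Rank1Residual.X2.CongruenceTransfer
import Literature.NumberTheory.EllipticCurves.IwasawaSelmerDualProofs
import Literature.NumberTheory.EllipticCurves.IwasawaSelmerModuleFiniteProofs
import HarnessLib

/-!
# Crux `MazurMCOnCellB` (stmt-BirchSwinnertonDyer-19033), line `mudescent`, stub
# `stub_analyticMuZero_offLocus` — helper 5: WHERE in an X2b isogeny class analytic `μ = 0` can hold —
# exactly at the off-locus members, as soon as it holds anywhere (cell `bsd-eis`, seat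
# `bsd-eis-mu-a`, PART 1b seat (1))

Complement to helper 4 (`…AnalyticMuOffLocus`: `μ_an` is MINIMAL at the off-locus member, and the
stub ⟺ «some member has `μ_an = 0`»). Relative to the route's published inputs — Greenberg, LNM 1716
Prop. 5.7 (`h57`, tree fact `Greenberg1999.prop57_one_le_mu_of_ramified_odd_line`), Wuthrich 2014
Thm. 16 at a reducible multiplicative prime (`hWu`, `Wuthrich2014.thm16_charIdeal_dvd_multiplicative_of_reducible`)
and modularity (`hpar`, `ModularForms.nonempty_modularParametrizationData`) — this file records:

* §1 `not_analyticMuLE_zero_of_hasRamifiedOddLineAt` — **ON the `μ`-barrier locus the certificate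
  `X2.AnalyticMuLE W p 0` is FALSE**: `μ_an(W) = 0` would force `μ(X(W/ℚ_∞)) = 0` by Kato–Wuthrich
  (tree: `X2.isTorsion_and_mu_eq_zero_of_analyticMuLE_zero`, unit `eisenstein-p2`), against Prop. 5.7
  (`EisensteinMuBarrier.mu_ne_zero`). The analytic twin of the barrier at `p ‖ N` (the X1 twin is
  mu-b's `…MazurMCOnX1RankZeroAnalyticMuOffLocus.not_analyticMuLE_zero_of_leaf_of_ramified_line`; the
  X2 ingredients are mu-c's, whose `…CongruenceRoadIsogeny` states the same contradiction under a
  transfer hypothesis). So the stub's hypothesis `¬ HasRamifiedOddLineAt W₀ p` is NECESSARY.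
* §2 `analyticMuLE_iff_of_offLocus` (UNCONDITIONAL) — two off-locus members of one X2b class have the
  SAME analytic `μ` (both are `p`-adically period-maximal by the ladder of helper 3): the stub's
  conclusion does not depend on WHICH off-locus member the landed `stub_locate` (p443911) returns.
* §3 `analyticMuLE_zero_iff_not_hasRamifiedOddLineAt_of_exists` — **in an X2b class containing SOME
  member with `μ_an = 0`, a member has `μ_an = 0` iff it is off the locus** (Greenberg's picture
  `μ(11a1, 11a2, 11a3) = (1, 2, 0)` at `5`, LNM 1716 §5, in the analytic currency at `p ‖ N`).

HONEST FRAMING: theorems only (no definition, no named fact, no `sorry`); §1 and §3 are CONDITIONAL on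
the three published inputs exactly as the route's `Assembly` carries them (stub 1 `PublishedInputs`);
nothing here proves the stub (= the class-wide expectation «some member has `μ_an = 0`», Stevens
1989 Rem. 4.14 / Greenberg–Vatsal 2000 Rem. after Cor. (3.8)), which stays OPEN. References:
[GreenbergLNM1716] Prop. 5.7 (p. 113), Conj. 1.11 (p. 58), §5 (`X₀(11)`); [Wuthrich2014] Thm. 16
(p. 397); [Stevens1989] Rem. 4.14; [GreenbergVatsal2000] §3 Remark after Cor. (3.8) (p. 40).
-/

set_option autoImplicit false

noncomputable section

open scoped Classical

open WeierstrassCurve NumberField IsDedekindDomain Field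
  Literature.NumberTheory.EllipticCurves
  Literature.NumberTheory.EllipticCurves.Rank1Residual
  Literature.NumberTheory.GaloisRepresentations
  Literature.Barriers.BirchSwinnertonDyer
  Summit.BirchSwinnertonDyer.Rank1Residual
  Summit.BirchSwinnertonDyer.BirchSwinnertonDyer.Theorems.EisensteinPrimesMazurMCOnCellBTypeAPeriodLadder
  Summit.BirchSwinnertonDyer.BirchSwinnertonDyer.Theorems.EisensteinPrimesMazurMCOnCellBAnalyticMuOffLocus

-- `Summit.BirchSwinnertonDyer.BirchSwinnertonDyer.…`: the summit and its single sub-problem share a name (D-0017 layout).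
set_option linter.dupNamespace false

namespace Summit.BirchSwinnertonDyer.BirchSwinnertonDyer.Theorems.EisensteinPrimesMazurMCOnCellBAnalyticMuLocus

variable {W W' : WeierstrassCurve ℚ} [W.IsElliptic] [W'.IsElliptic] [W.IsGloballyMinimal]
  [W'.IsGloballyMinimal] {p : ℕ} [hp : Fact p.Prime]

/-! ## §1. On the locus, `μ_an = 0` is false (relative to Prop. 5.7, Wuthrich Thm. 16, modularity) -/

omit [W'.IsElliptic] [W'.IsGloballyMinimal] in
/-- **On the `μ`-barrier locus the certificate `μ_an = 0` is FALSE.** For `W` globally minimal with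
multiplicative reduction at the odd prime `p`, `E[p]` reducible, and a rational `p`-line RAMIFIED at `p`
and ODD (`HasRamifiedOddLineAt W p`), relative to Greenberg's Prop. 5.7 (`h57`), Wuthrich 2014
Thm. 16 (`hWu`) and modularity (`hpar`): `¬ X2.AnalyticMuLE W p 0`. Indeed `μ_an(W) = 0` gives
`μ(X(W/ℚ_∞)) = 0` for every cyclotomic dual datum (Kato–Wuthrich divisibility,
`X2.isTorsion_and_mu_eq_zero_of_analyticMuLE_zero`), whereas Prop. 5.7 gives `μ ≥ 1` there
(`EisensteinMuBarrier.mu_ne_zero`). [cite: GreenbergLNM1716, Prop. 5.7 (p. 113)] [cite: Wuthrich2014, Thm. 16 (p. 397)] -/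
theorem not_analyticMuLE_zero_of_hasRamifiedOddLineAt
    (h57 : Greenberg1999.prop57_one_le_mu_of_ramified_odd_line)
    (hWu : Wuthrich2014.thm16_charIdeal_dvd_multiplicative_of_reducible)
    (hpar : ModularForms.nonempty_modularParametrizationData)
    (hp2 : p ≠ 2) (hmult : W.HasMultiplicativeReductionAtPrime p)
    (hred : ¬ W.HasIrreducibleModPGaloisRep p) (hloc : HasRamifiedOddLineAt W p) :
    ¬ X2.AnalyticMuLE W p 0 := by
  intro hμ
  obtain ⟨κ, hκ, γ, hγ, hγ'⟩ := exists_isCyclotomic_isTopGenerator_isCyclotomicVariable_holds p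
  obtain ⟨D⟩ := W.nonempty_selmerDualData_holds κ γ hγ
  haveI : Module.Finite (IwasawaAlgebra p) D.X := D.module_finite_holds hγ
  obtain ⟨hD, hmu⟩ :=
    X2.isTorsion_and_mu_eq_zero_of_analyticMuLE_zero hWu hpar hp2 hmult hred hμ hκ hγ hγ' D
  exact EisensteinMuBarrier.mu_ne_zero h57 hp2 (Or.inr hmult) hloc hκ hγ D hD hmu

omit [W'.IsElliptic] [W'.IsGloballyMinimal] in
/-- **The stub's hypothesis is necessary** (contrapositive of §1 on the cell): an X2 pair (`p` odd,
`E[p]` reducible, `p ‖ N`) with `μ_an = 0` is OFF the `μ`-barrier locus. Relative to Prop. 5.7,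
Wuthrich Thm. 16, modularity. [cite: GreenbergLNM1716, Prop. 5.7 (p. 113)] [cite: Wuthrich2014, Thm. 16 (p. 397)] -/
theorem not_hasRamifiedOddLineAt_of_analyticMuLE_zero
    (h57 : Greenberg1999.prop57_one_le_mu_of_ramified_odd_line)
    (hWu : Wuthrich2014.thm16_charIdeal_dvd_multiplicative_of_reducible)
    (hpar : ModularForms.nonempty_modularParametrizationData)
    (hX : ClassX2 W p) (hμ : X2.AnalyticMuLE W p 0) : ¬ HasRamifiedOddLineAt W p :=
  fun hloc ↦ not_analyticMuLE_zero_of_hasRamifiedOddLineAt h57 hWu hpar hX.1 hX.2.2 hX.2.1 hloc hμ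

/-! ## §2. Two off-locus members have the same analytic `μ` (unconditional) -/

/-- **The stub's conclusion does not depend on the choice of the off-locus member.** For two
`ℚ`-isogenous globally minimal curves `W`, `W'`, both OFF the `μ`-barrier locus, with `X2.CellB W p`:
`X2.AnalyticMuLE W p m ↔ X2.AnalyticMuLE W' p m` for every `m` (helper 4's minimality in both
directions; equivalently, two étale ends of one type-A class differ by an isogeny of degree prime to
`p`, their Néron periods by a `p`-adic unit). [cite: Stevens1989, Thm. 2.3 and Rem. 4.14]
[cite: GreenbergVatsal2000, §3, Remark after Cor. (3.8) (p. 40)] -/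
theorem analyticMuLE_iff_of_offLocus (hc : X2.CellB W p) (hoff : ¬ HasRamifiedOddLineAt W p)
    (hoff' : ¬ HasRamifiedOddLineAt W' p) (hiso : IsIsogenous W W') (m : ℕ) :
    X2.AnalyticMuLE W p m ↔ X2.AnalyticMuLE W' p m := by
  obtain hc' : X2.CellB W' p :=
    (X2.cellB_iff_of_isIsogenous (p := p) TateCurve.Silverman1994_thmV53_tateUniformisation_holds
      TateCurve.Silverman1994_thmV53_corV54_tateUniformisation_holds hiso).mp hc
  exact ⟨fun h ↦ analyticMuLE_offLocus_of_isIsogenous hc' hoff' hiso m h,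
    fun h ↦ analyticMuLE_offLocus_of_isIsogenous hc hoff hiso.symm_of_charZero m h⟩

/-! ## §3. In a class where `μ_an = 0` holds somewhere, it holds exactly off the locus -/

/-- **Greenberg's picture in the analytic currency at `p ‖ N`.** Relative to Prop. 5.7, Wuthrich
Thm. 16 and modularity: in an X2b isogeny class (`X2.CellB W p`) containing SOME globally minimal
member `W'` with `X2.AnalyticMuLE W' p 0`, a member `W` has `X2.AnalyticMuLE W p 0` **iff** it is
OFF the `μ`-barrier locus (`¬ HasRamifiedOddLineAt W p`). «⇒» is §1; «⇐» is helper 4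
(`analyticMuLE_offLocus_of_isIsogenous`). At `X₀(11)`, `p = 5` (good ordinary twin):
`μ(11a1, 11a2, 11a3) = (1, 2, 0)`, `11a3` being the only member off the locus.
[cite: GreenbergLNM1716, Prop. 5.7 (p. 113), Conj. 1.11 (p. 58) and §5] [cite: Wuthrich2014, Thm. 16 (p. 397)] -/
theorem analyticMuLE_zero_iff_not_hasRamifiedOddLineAt_of_exists
    (h57 : Greenberg1999.prop57_one_le_mu_of_ramified_odd_line)
    (hWu : Wuthrich2014.thm16_charIdeal_dvd_multiplicative_of_reducible)
    (hpar : ModularForms.nonempty_modularParametrizationData)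
    (hc : X2.CellB W p) (hiso : IsIsogenous W' W) (hμ' : X2.AnalyticMuLE W' p 0) :
    X2.AnalyticMuLE W p 0 ↔ ¬ HasRamifiedOddLineAt W p :=
  ⟨not_hasRamifiedOddLineAt_of_analyticMuLE_zero h57 hWu hpar hc.2.1,
    fun hoff ↦ analyticMuLE_offLocus_of_isIsogenous hc hoff hiso 0 hμ'⟩

omit [W'.IsElliptic] [W'.IsGloballyMinimal] in
/-- **The set of `μ_an = 0` members of an X2b class is EMPTY or EXACTLY the off-locus members**
(relative to Prop. 5.7, Wuthrich Thm. 16, modularity): packaged dichotomy of §1 and helper 4. The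
registered stub `stub_analyticMuZero_offLocus` asserts that the second alternative always holds
(helper 4, `stub_analyticMuZero_offLocus_iff_exists_member`). [cite: GreenbergLNM1716, Prop. 5.7 (p. 113) and Conj. 1.11 (p. 58)]
[cite: Stevens1989, Rem. 4.14] -/
theorem analyticMuLE_zero_dichotomy
    (h57 : Greenberg1999.prop57_one_le_mu_of_ramified_odd_line)
    (hWu : Wuthrich2014.thm16_charIdeal_dvd_multiplicative_of_reducible)
    (hpar : ModularForms.nonempty_modularParametrizationData) (hc : X2.CellB W p) :
    (∀ (V : WeierstrassCurve ℚ) [V.IsElliptic] [V.IsGloballyMinimal], IsIsogenous V W →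
        ¬ X2.AnalyticMuLE V p 0) ∨
      (∀ (V : WeierstrassCurve ℚ) [V.IsElliptic] [V.IsGloballyMinimal], IsIsogenous V W →
        (X2.AnalyticMuLE V p 0 ↔ ¬ HasRamifiedOddLineAt V p)) := by
  by_cases hex : ∃ (V : WeierstrassCurve ℚ) (_ : V.IsElliptic) (_ : V.IsGloballyMinimal),
      IsIsogenous V W ∧ X2.AnalyticMuLE V p 0
  · obtain ⟨V₀, _, _, hiso₀, hμ₀⟩ := hex
    refine Or.inr fun V _ _ hiso ↦ ?_
    obtain hcV : X2.CellB V p :=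
      (X2.cellB_iff_of_isIsogenous (p := p) TateCurve.Silverman1994_thmV53_tateUniformisation_holds
        TateCurve.Silverman1994_thmV53_corV54_tateUniformisation_holds hiso).mpr hc
    exact analyticMuLE_zero_iff_not_hasRamifiedOddLineAt_of_exists h57 hWu hpar hcV
      (hiso₀.trans' hiso.symm_of_charZero) hμ₀
  · refine Or.inl fun V _ _ hiso hμ ↦ hex ⟨V, inferInstance, inferInstance, hiso, hμ⟩

end Summit.BirchSwinnertonDyer.BirchSwinnertonDyer.Theorems.EisensteinPrimesMazurMCOnCellBAnalyticMuLocus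

end
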